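import Summits.BirchSwinnertonDyer.BirchSwinnertonDyer.Theorems.ResidualThetaTransportAtTwoResidualSignedLambdaLowerCMAtTwoFourTermOneSided
import Mathlib.Algebra.Module.CharacterModule
import HarnessLib

/-!
# N5 algebra for RSL_g: the ONE-SIDED four-term sequence CONSTRUCTED by Pontryagin dualization from an abstract
# local pairing, easy reciprocity on `Z`, and the DEEP HALF of global duality up to torsion

Route `ResidualThetaTransportAtTwo` (RTT), crux RSL_g `ResidualSignedLambdaLowerCMAtTwo` (stmt-BirchSwinnertonDyer-22608;
the (R≥)ᵖ crux stmt-BirchSwinnertonDyer-26074 is glue above it), DAG node N5 (`RSLG-LINE-DAG-g14.md`) in the re-cut form of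
STUB-PLAN rev 5 §11.2 («stub_fourTermSigma: exactness duties = hQ only»). Seat `prover-bsd-wall-rtt-p2` g16 (`--supports`,
closes nothing). THEOREMS ONLY (no definition, no named fact, no instance, no `sorry`); pure module algebra — nothing about
curves, Galois cohomology or L-functions; BSD is not proved by any of this; 22608 / 26074 stay OPEN.

## Setting (the abstract shape of Kobayashi's (7.21) at the plus quotient)
`A` a commutative ring (`= 𝒪`); `A`-modules `Sel` (`= Sel⁺(ℚ_∞, A_g)`, a scalar-stable subgroup of `H¹`), `P` (the COMPACT local
side at `p`: `𝒪`-valued functionals on the tower points modulo the annihilator of the plus points, `≅ Λ_𝒪` by `Col⁺`),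
`H` (`= 𝐇¹(T_g)`, Kato's Iwasawa cohomology); `A`-linear `pair : P → Sel⋆` (`Sel⋆ = CharacterModule Sel = Hom(Sel, ℚ/ℤ)`:
the local Tate / Kummer pairing `z ↦ (s ↦ ⟨z, res_p s⟩)`), `locd : H → P` (localisation at `p`), `Z ≤ H` (the zeta span),
`Sel₀ ≤ Sel` (strict at `p`: orthogonal to all of `P`). Hypotheses, each a named node:
* (EH_Z) `∀ z ∈ Z, pair (locd z) = 0` — the EASY half of reciprocity (sum of local invariants), needed on `Z` only;
* (ORTH) `∀ s ∈ Sel₀, ∀ z, pair z s = 0` — `Sel₀` is strict at `p`;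
* (DH) `∀ z, pair z = 0 → ∃ a ≠ 0, ∃ x, a•z = locd x` — the DEEP half of Poitou–Tate at the plus quotient, up to `A`-torsion
  (shape of TP2's `stub_poitouTateDeepTwo`: a local functional killing `res_p(Sel⁺)` is, times `2^m`, a global Iwasawa class).
Then with `Q := P ⧸ locd(Z)`, `f := locd mod Z : H/Z → Q`, `g := pair : Q → Sel⋆`, `h := restriction : Sel⋆ → Sel₀⋆`:
* §1 `map_le_ker_of_pair_locd`, **`exists_smul_mem_range_mapQ_of_mem_ker_liftQ`** (`ker g ≤ range f` up to torsion ⟸ (DH)),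
  **`range_liftQ_le_ker_dual_subtype`** (`range g ≤ ker h` ⟸ (ORTH)), `dual_subtype_surjective` (`h` onto: `ℚ/ℤ` is injective);
* §2 **`ker_baseChange_le_range_baseChange_of_smul_mem_range`** — «`ker g ≤ range f` up to `A`-torsion» descends to
  `ker (K ⊗ g) ≤ range (K ⊗ f)` over `K = Frac A`;
* §3 **`le_finrank_baseChange_characterModule_of_duality`** — `m ≤ λ(P/locd Z)` and the flank `λ(H/Z) ≤ λ(Sel₀⋆)` give
  `m ≤ λ(Sel⋆)`; **`…_decorated`** — with `d + e ≤ λ(P/locd Z)`, `λ(H/Z) ≤ λ(H2) + e`, `λ(H2) ≤ λ(Sel₀⋆)` gives `d ≤ λ(Sel⋆)`.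
So after this file the N5 duty of the 22608 line is: supply `(P, pair, locd)` on the real carriers with (EH_Z), (ORTH), (DH) and
the three finiteness instances; N3 (`f` injective) is not consumed.

References: [Kobayashi2003] Thm. 7.3 ((7.17)–(7.21)); [MilneADT2006] Ch. I Thm. 4.10; [GreenbergVatsal2000] §2; [Washington1997] §13.2.
-/

set_option autoImplicit false
-- the Theorems namespace of this sub repeats the summit name by design (D-0017 nested layout)
set_option linter.dupNamespace false

noncomputable section

open scoped TensorProduct Classical

namespace Summit.BirchSwinnertonDyer.BirchSwinnertonDyer.Theorems.CharIdealLambda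

universe u v w

/-! ## §1 The three one-sided exactness properties from (EH_Z), (ORTH), (DH) -/

section Duality

variable {A : Type u} [CommRing A]
  {Sel : Type v} [AddCommGroup Sel] [Module A Sel]
  {P : Type v} [AddCommGroup P] [Module A P]
  {H : Type v} [AddCommGroup H] [Module A H]
  (pair : P →ₗ[A] CharacterModule Sel) (locd : H →ₗ[A] P) (Z : Submodule A H)

/-- (EH_Z) ⇒ `locd(Z) ≤ ker pair`: the pairing `g = pair` descends to `Q = P ⧸ locd(Z)`. (Easy reciprocity: a global compact
class pairs to zero with every global Selmer class at `p`, the other local terms vanishing.)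
[cite: Kobayashi2003, Thm. 7.3 ((7.17)–(7.21), pp. 12–13)] -/
theorem map_le_ker_of_pair_locd (hEH : ∀ z ∈ Z, pair (locd z) = 0) :
    Z.map locd ≤ LinearMap.ker pair := by
  rintro _ ⟨z, hz, rfl⟩
  exact LinearMap.mem_ker.mpr (hEH z hz)

omit [Module A Sel] [AddCommGroup P] [Module A P] in
/-- `Z ≤ comap locd (locd Z)` — the well-definedness of `f = locd mod Z : H ⧸ Z → P ⧸ locd(Z)`. [folklore] -/
theorem le_comap_map_locd {P' : Type v} [AddCommGroup P'] [Module A P'] (locd' : H →ₗ[A] P') :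
    Z ≤ (Z.map locd').comap locd' :=
  fun _ hz ↦ Submodule.mem_map_of_mem hz

/-- **`ker g ≤ range f` UP TO TORSION ⟸ (DH).** With `g := liftQ pair : P ⧸ locd(Z) → Sel⋆` and
`f := mapQ locd : H ⧸ Z → P ⧸ locd(Z)`: every `q ∈ ker g` has a non-zero multiple in `range f`. ((DH) = the deep half of
Poitou–Tate at the plus quotient, in functional form and up to `A`-torsion: a local functional orthogonal to `res_p(Sel⁺)` is,
after a non-zero scalar, the localisation of a global Iwasawa class.)
[cite: Kobayashi2003, Thm. 7.3 (ii) ((7.17)–(7.21), pp. 12–13)] [cite: MilneADT2006, Ch. I, Thm. 4.10 (b)] -/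
theorem exists_smul_mem_range_mapQ_of_mem_ker_liftQ (hle : Z.map locd ≤ LinearMap.ker pair)
    (hDH : ∀ z : P, pair z = 0 → ∃ a : A, a ≠ 0 ∧ ∃ x : H, a • z = locd x)
    (q : P ⧸ Z.map locd) (hq : q ∈ LinearMap.ker ((Z.map locd).liftQ pair hle)) :
    ∃ a : A, a ≠ 0 ∧ a • q ∈ LinearMap.range (Z.mapQ (Z.map locd) locd (le_comap_map_locd Z locd)) := by
  induction q using Submodule.Quotient.induction_on with
  | H z =>
    rw [LinearMap.mem_ker, Submodule.liftQ_apply] at hq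
    obtain ⟨a, ha, x, hx⟩ := hDH z hq
    refine ⟨a, ha, Submodule.Quotient.mk x, ?_⟩
    rw [Submodule.mapQ_apply, ← hx, Submodule.Quotient.mk_smul]

/-- **`range g ≤ ker h` ⟸ (ORTH).** With `h := (Sel₀ ↪ Sel)⋆ : Sel⋆ → Sel₀⋆`: the character `pair z` restricts to zero on a
submodule `Sel₀` orthogonal to `P` (strict at `p`). [cite: Kobayashi2003, Thm. 7.3 ((7.21), p. 13)] -/
theorem range_liftQ_le_ker_dual_subtype (hle : Z.map locd ≤ LinearMap.ker pair) (Sel₀ : Submodule A Sel)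
    (horth : ∀ s ∈ Sel₀, ∀ z : P, pair z s = 0) :
    LinearMap.range ((Z.map locd).liftQ pair hle) ≤ LinearMap.ker (CharacterModule.dual Sel₀.subtype) := by
  rintro _ ⟨q, rfl⟩
  induction q using Submodule.Quotient.induction_on with
  | H z =>
    rw [LinearMap.mem_ker, Submodule.liftQ_apply]
    ext s
    exact horth s s.2 z

omit [AddCommGroup P] [Module A P] [AddCommGroup H] [Module A H] in
/-- **`h` is onto**: characters extend from a submodule (`ℚ/ℤ` is an injective `ℤ`-module; `Sel₀⋆ ← Sel⋆` surjective, i.e.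
`X⁺ → X₀` onto as `Sel₀ ⊆ Sel⁺`). [folklore] -/
theorem dual_subtype_surjective (Sel₀ : Submodule A Sel) :
    Function.Surjective (CharacterModule.dual Sel₀.subtype) :=
  CharacterModule.dual_surjective_of_injective _ Sel₀.injective_subtype

end Duality

/-! ## §2 «`ker g ≤ range f` up to torsion» descends to the fraction field -/

section Descent

variable {A : Type u} [CommRing A] (K : Type w) [Field K] [Algebra A K] [IsFractionRing A K]
variable {V₁ Q X : Type v} [AddCommGroup V₁] [Module A V₁] [AddCommGroup Q] [Module A Q]
  [AddCommGroup X] [Module A X]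

/-- **Torsion-tolerant descent**: if every element of `ker g` has a NON-ZERO multiple in `range f`, then over `K = Frac A`
`ker (K ⊗ g) ≤ range (K ⊗ f)` (flatness: `ker (K ⊗ g) = K ⊗ ker g`; and `k ⊗ v = (k/a) ⊗ a•v`). [folklore] -/
theorem ker_baseChange_le_range_baseChange_of_smul_mem_range (f : V₁ →ₗ[A] Q) (g : Q →ₗ[A] X)
    (hQ : ∀ q ∈ LinearMap.ker g, ∃ a : A, a ≠ 0 ∧ a • q ∈ LinearMap.range f) :
    LinearMap.ker (g.baseChange K) ≤ LinearMap.range (f.baseChange K) := by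
  haveI : Module.Flat A K := IsLocalization.flat K (nonZeroDivisors A)
  intro x hx
  have hx' : x ∈ LinearMap.ker (g.lTensor K) := by
    rw [LinearMap.mem_ker] at hx ⊢
    rwa [LinearMap.baseChange_eq_ltensor] at hx
  have hker : LinearMap.ker (g.lTensor K) = LinearMap.range ((LinearMap.ker g).subtype.lTensor K) :=
    (Module.Flat.lTensor_exact K (LinearMap.exact_subtype_ker_map g)).linearMap_ker_eq
  rw [hker] at hx'
  obtain ⟨y, rfl⟩ := hx'
  have : LinearMap.range ((LinearMap.ker g).subtype.lTensor K) ≤ LinearMap.range (f.lTensor K) := by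
    rw [LinearMap.range_le_iff_comap, Submodule.eq_top_iff']
    intro t
    simp only [Submodule.mem_comap]
    induction t using TensorProduct.induction_on with
    | zero => simp
    | tmul k v =>
        obtain ⟨a, ha, w, hw⟩ := hQ (v : Q) v.2
        have haK : algebraMap A K a ≠ 0 := fun h0 ↦
          ha ((injective_iff_map_eq_zero (algebraMap A K)).mp (IsFractionRing.injective A K) a h0)
        refine ⟨((algebraMap A K a)⁻¹ * k) ⊗ₜ w, ?_⟩
        rw [LinearMap.lTensor_tmul, hw, ← TensorProduct.smul_tmul, LinearMap.lTensor_tmul, Submodule.subtype_apply,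
          Algebra.smul_def, ← mul_assoc, mul_inv_cancel₀ haK, one_mul]
    | add a b ha hb => rw [map_add]; exact Submodule.add_mem _ ha hb
  obtain ⟨t, ht⟩ := this ⟨y, rfl⟩
  exact ⟨t, by rw [LinearMap.baseChange_eq_ltensor, ht]⟩

end Descent

/-! ## §3 The corank bound `m ≤ λ(Sel⋆)` from (EH_Z), (ORTH), (DH), `hm` and the flank -/

section Bound

variable {A : Type u} [CommRing A] (K : Type w) [Field K] [Algebra A K] [IsFractionRing A K]
  {Sel : Type v} [AddCommGroup Sel] [Module A Sel]
  {P : Type v} [AddCommGroup P] [Module A P]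
  {H : Type v} [AddCommGroup H] [Module A H]
  (pair : P →ₗ[A] CharacterModule Sel) (locd : H →ₗ[A] P) (Z : Submodule A H) (Sel₀ : Submodule A Sel)

/-- **THE N5 CORANK BOUND (one-sided four-term sequence from duality).** `K = Frac A` (a field, so `A` is a domain),
λ-currency `dim_K (K ⊗_A ·)`. Given the abstract local pairing `pair : P → Sel⋆`, the localisation `locd : H → P`, the zeta span
`Z ≤ H` and the strict submodule `Sel₀ ≤ Sel` with (EH_Z), (ORTH), (DH), and `K ⊗ (H/Z)`, `K ⊗ (P/locd Z)`, `K ⊗ Sel⋆`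
finite-dimensional (`𝐇¹/Z`, `Λ_𝒪/(Col⁺(loc Z))` torsion; finite branch): `m ≤ λ(P/locd Z)` and `λ(H/Z) ≤ λ(Sel₀⋆)` give
`m ≤ λ(Sel⋆)`. (Kobayashi (7.21) with only the existence half of global duality consumed; N3 not used.)
[cite: Kobayashi2003, Thm. 7.3 ((7.21), p. 13)] [cite: MilneADT2006, Ch. I, Thm. 4.10] [cite: Washington1997, §13.2] -/
theorem le_finrank_baseChange_characterModule_of_duality
    (hEH : ∀ z ∈ Z, pair (locd z) = 0) (horth : ∀ s ∈ Sel₀, ∀ z : P, pair z s = 0)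
    (hDH : ∀ z : P, pair z = 0 → ∃ a : A, a ≠ 0 ∧ ∃ x : H, a • z = locd x)
    [Module.Finite K (K ⊗[A] (H ⧸ Z))] [Module.Finite K (K ⊗[A] (P ⧸ Z.map locd))]
    [Module.Finite K (K ⊗[A] CharacterModule Sel)] {m : ℕ}
    (hm : m ≤ Module.finrank K (K ⊗[A] (P ⧸ Z.map locd)))
    (hflank : Module.finrank K (K ⊗[A] (H ⧸ Z)) ≤ Module.finrank K (K ⊗[A] CharacterModule Sel₀)) :
    m ≤ Module.finrank K (K ⊗[A] CharacterModule Sel) := by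
  haveI : Module.Flat A K := IsLocalization.flat K (nonZeroDivisors A)
  have hle := map_le_ker_of_pair_locd pair locd Z hEH
  set f : (H ⧸ Z) →ₗ[A] (P ⧸ Z.map locd) := Z.mapQ (Z.map locd) locd (le_comap_map_locd Z locd) with hf
  set g : (P ⧸ Z.map locd) →ₗ[A] CharacterModule Sel := (Z.map locd).liftQ pair hle with hg
  set h : CharacterModule Sel →ₗ[A] CharacterModule Sel₀ := CharacterModule.dual Sel₀.subtype with hh
  have hker : ∀ q ∈ LinearMap.ker g, ∃ a : A, a ≠ 0 ∧ a • q ∈ LinearMap.range f :=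
    fun q hq ↦ exists_smul_mem_range_mapQ_of_mem_ker_liftQ pair locd Z hle hDH q hq
  have hcomp : LinearMap.range g ≤ LinearMap.ker h := range_liftQ_le_ker_dual_subtype pair locd Z hle Sel₀ horth
  have hhsurj : Function.Surjective h := dual_subtype_surjective Sel₀
  -- base change to `K`
  set f' := f.baseChange K with hf'
  set g' := g.baseChange K with hg'
  set h' := h.baseChange K with hh'
  have hh'surj : Function.Surjective h' := by
    rw [hh', LinearMap.baseChange_eq_ltensor]
    exact LinearMap.lTensor_surjective K hhsurj
  haveI : Module.Finite K (K ⊗[A] CharacterModule Sel₀) := Module.Finite.of_surjective h' hh'surj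
  have hker' : LinearMap.ker g' ≤ LinearMap.range f' :=
    ker_baseChange_le_range_baseChange_of_smul_mem_range K f g hker
  have hcomp' : LinearMap.range g' ≤ LinearMap.ker h' := by
    rintro _ ⟨y, rfl⟩
    have hy : (g.lTensor K) y ∈ LinearMap.ker (h.lTensor K) := range_lTensor_le_ker_lTensor K g h hcomp ⟨y, rfl⟩
    rw [LinearMap.mem_ker] at hy ⊢
    rw [hh', hg', LinearMap.baseChange_eq_ltensor, LinearMap.baseChange_eq_ltensor]
    exact hy
  exact le_finrank_of_fourTerm_oneSided f' g' h' hker' hcomp' hh'surj hm hflank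

/-- **The same, DECORATION-TOLERANT** (STUB-PLAN rev 5 §11.1–11.2, C1): with the joint HOLD clauses for a decorated zeta span
`Z = Λ·D·z_γ` — `d + e ≤ λ(P/locd Z)` (`e = λ(Λ/(D))`, read off `Col⁺_g(loc₂ z) = c·D·Lm` by normλ-additivity) and
`λ(H/Z) ≤ λ(H2) + e` (Burungale–Tian + the decoration shift) — and compact Poitou–Tate `λ(H2) ≤ λ(Sel₀⋆)`: `d ≤ λ(Sel⋆)`.
[cite: Kobayashi2003, Thm. 7.3 ((7.21), p. 13)] [cite: BurungaleTian2026, Thm. 2.6 (p. 5)] -/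
theorem le_finrank_baseChange_characterModule_of_duality_decorated {H2 : Type v} [AddCommGroup H2] [Module A H2]
    (hEH : ∀ z ∈ Z, pair (locd z) = 0) (horth : ∀ s ∈ Sel₀, ∀ z : P, pair z s = 0)
    (hDH : ∀ z : P, pair z = 0 → ∃ a : A, a ≠ 0 ∧ ∃ x : H, a • z = locd x)
    [Module.Finite K (K ⊗[A] (H ⧸ Z))] [Module.Finite K (K ⊗[A] (P ⧸ Z.map locd))]
    [Module.Finite K (K ⊗[A] CharacterModule Sel)] {d e : ℕ}
    (hi : d + e ≤ Module.finrank K (K ⊗[A] (P ⧸ Z.map locd)))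
    (hii : Module.finrank K (K ⊗[A] (H ⧸ Z)) ≤ Module.finrank K (K ⊗[A] H2) + e)
    (hPT : Module.finrank K (K ⊗[A] H2) ≤ Module.finrank K (K ⊗[A] CharacterModule Sel₀)) :
    d ≤ Module.finrank K (K ⊗[A] CharacterModule Sel) := by
  haveI : Module.Flat A K := IsLocalization.flat K (nonZeroDivisors A)
  have hle := map_le_ker_of_pair_locd pair locd Z hEH
  set f : (H ⧸ Z) →ₗ[A] (P ⧸ Z.map locd) := Z.mapQ (Z.map locd) locd (le_comap_map_locd Z locd) with hf
  set g : (P ⧸ Z.map locd) →ₗ[A] CharacterModule Sel := (Z.map locd).liftQ pair hle with hg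
  set h : CharacterModule Sel →ₗ[A] CharacterModule Sel₀ := CharacterModule.dual Sel₀.subtype with hh
  have hker : ∀ q ∈ LinearMap.ker g, ∃ a : A, a ≠ 0 ∧ a • q ∈ LinearMap.range f :=
    fun q hq ↦ exists_smul_mem_range_mapQ_of_mem_ker_liftQ pair locd Z hle hDH q hq
  have hcomp : LinearMap.range g ≤ LinearMap.ker h := range_liftQ_le_ker_dual_subtype pair locd Z hle Sel₀ horth
  have hhsurj : Function.Surjective h := dual_subtype_surjective Sel₀
  set f' := f.baseChange K with hf'
  set g' := g.baseChange K with hg'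
  set h' := h.baseChange K with hh'
  have hh'surj : Function.Surjective h' := by
    rw [hh', LinearMap.baseChange_eq_ltensor]
    exact LinearMap.lTensor_surjective K hhsurj
  haveI : Module.Finite K (K ⊗[A] CharacterModule Sel₀) := Module.Finite.of_surjective h' hh'surj
  have hker' : LinearMap.ker g' ≤ LinearMap.range f' :=
    ker_baseChange_le_range_baseChange_of_smul_mem_range K f g hker
  have hcomp' : LinearMap.range g' ≤ LinearMap.ker h' := by
    rintro _ ⟨y, rfl⟩
    have hy : (g.lTensor K) y ∈ LinearMap.ker (h.lTensor K) := range_lTensor_le_ker_lTensor K g h hcomp ⟨y, rfl⟩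
    rw [LinearMap.mem_ker] at hy ⊢
    rw [hh', hg', LinearMap.baseChange_eq_ltensor, LinearMap.baseChange_eq_ltensor]
    exact hy
  have h1 := g'.finrank_range_add_finrank_ker
  have h2 := h'.finrank_range_add_finrank_ker
  have h3 : Module.finrank K (LinearMap.ker g') ≤ Module.finrank K (K ⊗[A] (H ⧸ Z)) :=
    (Submodule.finrank_mono hker').trans f'.finrank_range_le
  have h4 : Module.finrank K (LinearMap.range g') ≤ Module.finrank K (LinearMap.ker h') :=
    Submodule.finrank_mono hcomp'
  have h5 : Module.finrank K (LinearMap.range h') = Module.finrank K (K ⊗[A] CharacterModule Sel₀) := by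
    rw [LinearMap.range_eq_top.mpr hh'surj, finrank_top]
  omega

end Bound

end Summit.BirchSwinnertonDyer.BirchSwinnertonDyer.Theorems.CharIdealLambda

end
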